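import Summits.NavierStokesRegularity.NavierStokesRegularity.Theorems.AdaptedFrequencyAdaptedFrequencyConvergesStubDoeblinOneStep

/-!
# Crux `AdaptedFrequencyConverges` (stmt-NavierStokesRegularity-10493), line
  `cloud-frame-effective-tsai`: STUB `stub_doeblin` — kernel uniqueness by Doeblin's argument

Theorems file (lands `--supports stmt-NavierStokesRegularity-10493`) proving the registered stub
`stub_doeblin` of the line's skeleton EXACTLY as registered: GIVEN Kato `L¹` monotonicity for the
adjoint equation on closed blocks and the block solver for smooth compactly supported nonnegative
terminal data (the two other thirds of `kernelUniqueness`, verbatim, as hypotheses), the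
Gaussian-comparable adapted backward kernel with pole `(T, x₀)` of a smooth divergence-free Type-I
drift `‖b(t, x)‖ ≤ C/√(T − t)` on a time set `S ⊆ (−∞, T)` closed under `t ↦ [t, T)` is unique.

## Proof

Fix `t ∈ S` and the dyadic times `t_k = T − (T − t)/2^k ∈ [t, T) ⊆ S`; let
`a_k = ∫ |K₁(t_k) − K₂(t_k)| ∈ [0, 2]`. Only the UPPER Gaussian bounds of the two kernels are used
(with common constants `C₁ = max`, `C₂ = max`). For `ε > 0` choose the core radius `R` with
uniform tail `τ(R) = C₁(2πC₂)^{3/2}e^{−R²/(2C₂)} ≤ ε` (tightness, `doeblin_tail_le`); the one-step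
contraction `doeblin_oneStep` on the blocks `[t_{k+1}, t_{k+2}]` (room `[t_k, ·]`) reads
`a_{k+1} ≤ (1 − η) a_{k+2} + 2ηε` with a block-independent `η = η(ν, C, R) ∈ (0, 1]`
(minorisation by the tree's `IsDriftHeatSolutionOn.kernel_lower_bound`, all powers of the block
length cancel). Since the error carries the factor `η`, iterating gives
`a_1 ≤ 2(1 − η)^n + 2ε` for every `n`, hence `a_1 ≤ 2ε`, hence `a_1 = 0`; Kato on `[t, t_1]`
gives `a_0 = ∫|K₁(t) − K₂(t)| = 0`, and continuity gives `K₁(t, ·) = K₂(t, ·)`.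
-/

noncomputable section

namespace Summit.NavierStokesRegularity.NavierStokesRegularity.Theorems.AdaptedFrequencyConverges.CloudFrameEffectiveTsai

open scoped Topology Laplacian
open Literature.Analysis.FluidPDE Set Filter MeasureTheory Function Metric

/-! ### The dyadic times -/

/-- The dyadic times `t_k = T − (T − t)/2^k` of `[t, T)`: `t ≤ t_k < T`, `t_k < t_{k+1}`,
`T − t_k = 2 (T − t_{k+1})`. -/
theorem doeblin_dyadic {t T : ℝ} (ht : t < T) (k : ℕ) :
    t ≤ T - (T - t) / 2 ^ k ∧ T - (T - t) / 2 ^ k < T ∧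
      T - (T - t) / 2 ^ k < T - (T - t) / 2 ^ (k + 1) ∧
      T - (T - (T - t) / 2 ^ k) = 2 * (T - (T - (T - t) / 2 ^ (k + 1))) := by
  have hℓ : 0 < T - t := sub_pos.2 ht
  have h2k : (1:ℝ) ≤ 2 ^ k := one_le_pow₀ (by norm_num)
  have h2k0 : (0:ℝ) < 2 ^ k := by positivity
  refine ⟨?_, ?_, ?_, ?_⟩
  · have : (T - t) / 2 ^ k ≤ T - t := div_le_self hℓ.le h2k
    linarith
  · have : 0 < (T - t) / 2 ^ k := div_pos hℓ h2k0
    linarith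
  · have : (T - t) / 2 ^ (k + 1) < (T - t) / 2 ^ k :=
      div_lt_div_of_pos_left hℓ h2k0 (pow_lt_pow_right₀ (by norm_num) (Nat.lt_succ_self k))
    linarith
  · rw [pow_succ]
    field_simp
    ring

/-! ### The iteration -/

/-- **Geometric iteration with an `η`-weighted error.** If `0 < η ≤ 1`, `ε ≥ 0`, `a_k ≤ 2` and
`a_{k+1} ≤ (1 − η) a_{k+2} + 2ηε` for all `k`, then `a_1 ≤ 2ε`. -/
theorem doeblin_iterate {a : ℕ → ℝ} {η ε : ℝ} (hη0 : 0 < η) (hη1 : η ≤ 1) (hε : 0 ≤ ε)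
    (ha2 : ∀ k, a k ≤ 2) (hstep : ∀ k, a (k + 1) ≤ (1 - η) * a (k + 2) + 2 * η * ε) :
    a 1 ≤ 2 * ε := by
  have hq0 : 0 ≤ 1 - η := by linarith
  have hq1 : 1 - η < 1 := by linarith
  have hiter : ∀ n : ℕ, a 1 ≤ (1 - η) ^ n * a (n + 1) + 2 * ε * (1 - (1 - η) ^ n) := by
    intro n
    induction n with
    | zero => simp
    | succ n ih =>
      have hqn : 0 ≤ (1 - η) ^ n := pow_nonneg hq0 n
      have h1 := mul_le_mul_of_nonneg_left (hstep n) hqn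
      have e : (1 - η) ^ (n + 1) = (1 - η) ^ n * (1 - η) := pow_succ _ _
      rw [e]
      nlinarith [ih, h1]
  have hbound : ∀ n : ℕ, a 1 ≤ 2 * (1 - η) ^ n + 2 * ε := by
    intro n
    have hqn : 0 ≤ (1 - η) ^ n := pow_nonneg hq0 n
    have h1 : (1 - η) ^ n * a (n + 1) ≤ (1 - η) ^ n * 2 := mul_le_mul_of_nonneg_left (ha2 _) hqn
    have h2 : 0 ≤ ε * (1 - η) ^ n := mul_nonneg hε hqn
    nlinarith [hiter n]
  have hlim : Tendsto (fun n : ℕ => 2 * (1 - η) ^ n + 2 * ε) atTop (𝓝 (2 * 0 + 2 * ε)) :=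
    ((tendsto_pow_atTop_nhds_zero_of_lt_one hq0 hq1).const_mul 2).add_const _
  have := ge_of_tendsto hlim (Eventually.of_forall hbound)
  linarith


/-! ### Kernel uniqueness -/

/-- A continuous integrable function with `∫ |f| = 0` vanishes identically. -/
theorem doeblin_eq_zero_of_integral_abs {f : EuclideanSpace ℝ (Fin 3) → ℝ} (hf : Continuous f)
    (hfi : Integrable f) (h0 : ∫ x, |f x| = 0) : ∀ x, f x = 0 := by
  have hae : (fun x => |f x|) =ᵐ[volume] 0 :=
    (integral_eq_zero_iff_of_nonneg (fun x => abs_nonneg (f x)) hfi.abs).1 h0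
  have heq := (Continuous.ae_eq_iff_eq volume hf.abs continuous_const).1 hae
  intro x
  have h : |f x| = 0 := congr_fun heq x
  exact abs_eq_zero.1 h

/-! ### The stub -/

/-- **STUB `stub_doeblin` of line `cloud-frame-effective-tsai`** (Doeblin assembly ⇒ kernel
uniqueness; registered signature, verbatim): GIVEN Kato `L¹` monotonicity and the block solver,
the Gaussian-comparable adapted kernel with pole `(T, x₀)` of a smooth divergence-free Type-I
drift on a time set `S ⊆ (−∞, T)` closed under `t ↦ [t, T)` is UNIQUE. Proof: see the file
header. -/
theorem stub_doeblin :
    (∀ (ν B s s' A a : ℝ) (b : ℝ → (EuclideanSpace ℝ (Fin 3)) → (EuclideanSpace ℝ (Fin 3))) (W : ℝ → (EuclideanSpace ℝ (Fin 3)) → ℝ), 0 < ν → s < s' → 0 < a → IsSmoothSpaceTimeOn (Icc s s') b → (∀ τ ∈ Icc s s', VectorCalculus.IsDivFree (b τ)) → (∀ τ ∈ Icc s s', ∀ x, ‖b τ x‖ ≤ B) → ContDiffOn ℝ 2 (uncurry W) (Icc s s' ×ˢ univ) → (∀ τ ∈ Icc s s', ∀ x, timeDerivWithin (Icc s s') W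 τ x + fderiv ℝ (W τ) x (b τ x) + ν * Laplacian.laplacian (W τ) x = 0) → (∀ τ ∈ Icc s s', ∀ x, |W τ x| ≤ A * Real.exp (-‖x‖ ^ 2 / a)) → ∫ x, |W s x| ≤ ∫ x, |W s' x|) → (∀ (ν B s₀ s s' s₁ : ℝ) (b : ℝ → (EuclideanSpace ℝ (Fin 3)) → (EuclideanSpace ℝ (Fin 3))) (f : (EuclideanSpace ℝ (Fin 3)) → ℝ), 0 < ν → 0 ≤ B → s₀ < s → s < s' → s' < s₁ → IsSmoothSpaceTimeOn (Icc s₀ s₁) b → (∀ τ ∈ Icc s₀ s₁, VectorCalculus.IsDivFree (b τ)) → (∀ τ ∈ Icc s₀ s₁, ∀ x, ‖b τ x‖ ≤ B) → ContDiff ℝ (⊤ : ℕ∞) f → HasCompactSupport f → (∀ x, 0 ≤ f x) → ∃ W : ℝ → (EuclideanSpace ℝ (Fin 3)) → ℝ, ContDiffOn ℝ 2 (uncurry W) (Ico s s' ×ˢ univ) ∧ (∀ τ ∈ Ico s s', ∀ x, timeDerivWithin (Ico s s') W τ x + fderiv ℝ (W τ) x (b τ x) + ν * Laplacian.laplacian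 (W τ) x = 0) ∧ (∀ τ ∈ Ico s s', ∀ x, 0 ≤ W τ x) ∧ (∃ A a : ℝ, 0 < a ∧ ∀ τ ∈ Ico s s', ∀ x, W τ x ≤ A * Real.exp (-‖x‖ ^ 2 / a)) ∧ (∀ ε : ℝ, 0 < ε → ∃ s₂ ∈ Ico s s', ∀ τ ∈ Ico s₂ s', ∀ x, |W τ x - f x| ≤ ε)) → ∀ (ν C T : ℝ) (S : Set ℝ), 0 < ν → S ⊆ Iio T → (∀ t ∈ S, Ico t T ⊆ S) → ∀ (b : ℝ → (EuclideanSpace ℝ (Fin 3)) → (EuclideanSpace ℝ (Fin 3))), IsSmoothSpaceTimeOn S b → (∀ t ∈ S, VectorCalculus.IsDivFree (b t)) → (∀ t ∈ S, ∀ x, ‖b t x‖ ≤ C / Real.sqrt (T - t)) → ∀ (x₀ : (EuclideanSpace ℝ (Fin 3))) (K₁ K₂ : ℝ → (EuclideanSpace ℝ (Fin 3)) → ℝ), IsAdaptedBackwardKernel ν b S T x₀ K₁ → IsGaussianComparable K₁ S T x₀ → IsAdaptedBackwardKernel ν b S T x₀ K₂ → IsGaussianComparable K₂ S T x₀ → ∀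 t ∈ S, K₁ t = K₂ t := by
  intro hKato hBlock ν C T S hν hST hS b hb hdiv hbd x₀ K₁ K₂ hK₁ hG₁ hK₂ hG₂ t ht
  have htT : t < T := hST ht
  have hSt : Ico t T ⊆ S := hS t ht
  -- common upper Gaussian constants
  obtain ⟨_, _, A₁, B₁, -, -, hA₁, hB₁, hcmp₁⟩ := isGaussianComparable_iff_fin_three.1 hG₁
  obtain ⟨_, _, A₂, B₂, -, -, hA₂, hB₂, hcmp₂⟩ := isGaussianComparable_iff_fin_three.1 hG₂
  have hC₁ : 0 ≤ max A₁ A₂ := hA₁.le.trans (le_max_left _ _)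
  have hC₂ : 0 < max B₁ B₂ := hB₁.trans_le (le_max_left _ _)
  have hup : ∀ (K : ℝ → EuclideanSpace ℝ (Fin 3) → ℝ) (A B : ℝ), A ≤ max A₁ A₂ → 0 < B →
      B ≤ max B₁ B₂ → (∀ s ∈ S, ∀ x, K s x ≤
        A * (T - s) ^ (-(3:ℝ) / 2) * Real.exp (-(‖x - x₀‖ ^ 2) / (B * (T - s)))) →
      ∀ s ∈ S, ∀ x, K s x ≤
        max A₁ A₂ * (T - s) ^ (-(3:ℝ) / 2) * Real.exp (-(‖x - x₀‖ ^ 2) / (max B₁ B₂ * (T - s))) := by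
    intro K A B hA hB hBle hK s hs x
    have hTs : 0 < T - s := sub_pos.2 (hST hs)
    refine (hK s hs x).trans ?_
    have h1 : Real.exp (-(‖x - x₀‖ ^ 2) / (B * (T - s))) ≤
        Real.exp (-(‖x - x₀‖ ^ 2) / (max B₁ B₂ * (T - s))) := by
      refine Real.exp_le_exp.2 ?_
      rw [neg_div, neg_div, neg_le_neg_iff]
      exact div_le_div_of_nonneg_left (sq_nonneg _) (by positivity)
        (mul_le_mul_of_nonneg_right hBle hTs.le)
    have h2 : 0 ≤ (T - s) ^ (-(3:ℝ) / 2) := Real.rpow_nonneg hTs.le _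
    calc A * (T - s) ^ (-(3:ℝ) / 2) * Real.exp (-(‖x - x₀‖ ^ 2) / (B * (T - s)))
        ≤ max A₁ A₂ * (T - s) ^ (-(3:ℝ) / 2) *
            Real.exp (-(‖x - x₀‖ ^ 2) / (B * (T - s))) := by
          gcongr
      _ ≤ _ := mul_le_mul_of_nonneg_left h1 (mul_nonneg hC₁ h2)
  have hup₁ := hup K₁ A₁ B₁ (le_max_left _ _) hB₁ (le_max_left _ _) fun s hs x => (hcmp₁ s hs x).2
  have hup₂ := hup K₂ A₂ B₂ (le_max_right _ _) hB₂ (le_max_right _ _) fun s hs x => (hcmp₂ s hs x).2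
  -- the dyadic times and the masses of the difference
  set tk : ℕ → ℝ := fun k => T - (T - t) / 2 ^ k with htk
  have hdy := fun k => doeblin_dyadic htT k
  have htkS : ∀ k, tk k ∈ S := fun k => hSt ⟨(hdy k).1, (hdy k).2.1⟩
  have htk0 : tk 0 = t := by simp [htk]
  set a : ℕ → ℝ := fun k => ∫ x, |K₁ (tk k) x - K₂ (tk k) x| with ha
  have ha2 : ∀ k, a k ≤ 2 := by
    intro k
    have hi₁ := hK₁.integrable (htkS k)
    have hi₂ := hK₂.integrable (htkS k)
    calc a k ≤ ∫ x, (K₁ (tk k) x + K₂ (tk k) x) := by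
          refine integral_mono (hi₁.sub hi₂).abs (hi₁.add hi₂) fun x => ?_
          have h₁ := (hK₁.pos _ (htkS k) x).le
          have h₂ := (hK₂.pos _ (htkS k) x).le
          exact (abs_sub _ _).trans (by rw [abs_of_nonneg h₁, abs_of_nonneg h₂])
      _ = 2 := by
          rw [integral_add hi₁ hi₂, hK₁.integral_eq_one _ (htkS k), hK₂.integral_eq_one _ (htkS k)]
          norm_num
  -- `a 1 ≤ 2ε` for every `ε > 0`
  have ha1 : ∀ ε : ℝ, 0 < ε → a 1 ≤ 2 * ε := by
    intro ε hε
    -- the core radius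
    obtain ⟨R, hRτ, hR1⟩ :=
      (((doeblin_tail_tendsto_zero (max A₁ A₂) hC₂).eventually_lt_const hε).and
        (eventually_ge_atTop 1)).exists
    have hR : 0 < R := one_pos.trans_le hR1
    set η : ℝ := min 1 (kSubLow 3 (C / ν) (3 * R) ν * R ^ 3 *
      volume.real (ball (0 : EuclideanSpace ℝ (Fin 3)) 1)) with hη
    have hη'0 : 0 < kSubLow 3 (C / ν) (3 * R) ν * R ^ 3 *
        volume.real (ball (0 : EuclideanSpace ℝ (Fin 3)) 1) :=
      mul_pos (mul_pos (kSubLow_pos _ _ _ hν) (pow_pos hR 3)) doeblin_volume_unitBall_pos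
    have hη0 : 0 < η := lt_min one_pos hη'0
    have hη1 : η ≤ 1 := min_le_left _ _
    refine doeblin_iterate hη0 hη1 hε.le ha2 fun k => ?_
    -- one step on the block `[t_{k+1}, t_{k+2}]` with room `[t_k, ·]`
    have h01 := (hdy k).2.2.1
    have h12 := (hdy (k + 1)).2.2.1
    have h2T := (hdy (k + 2)).2.1
    have hℓ := (hdy (k + 1)).2.2.2
    have hI : Icc (tk k) (tk (k + 2) + (T - tk (k + 2)) / 2) ⊆ S := fun s hs =>
      hSt ⟨(hdy k).1.trans hs.1, hs.2.trans_lt (by linarith)⟩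
    have hstep := doeblin_oneStep hKato hBlock hν hST hb hdiv hbd hK₁ hK₂ hC₁ hC₂ hup₁ hup₂ hR
      h01 h12 h2T hℓ hI
    have hτ : 2 * η * (max A₁ A₂ * (2 * Real.pi * max B₁ B₂) ^ ((3:ℝ) / 2) *
        Real.exp (-R ^ 2 / (2 * max B₁ B₂))) ≤ 2 * η * ε :=
      mul_le_mul_of_nonneg_left hRτ.le (by positivity)
    show a (k + 1) ≤ (1 - η) * a (k + 2) + 2 * η * ε
    exact hstep.trans (by linarith)
  have ha1' : a 1 = 0 := by
    refine le_antisymm ?_ (integral_nonneg fun x => abs_nonneg _)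
    refine le_of_forall_pos_le_add fun ε hε => ?_
    have := ha1 (ε / 2) (half_pos hε)
    linarith
  -- Kato on `[t, t_1]`
  have h0 : ∫ x, |K₁ t x - K₂ t x| = 0 := by
    have hI1 : Icc t (tk 1) ⊆ S := fun s hs => hSt ⟨hs.1, hs.2.trans_lt (hdy 1).2.1⟩
    have hlt : t < tk 1 := by
      show t < T - (T - t) / 2 ^ 1
      have h := (hdy 0).2.2.1
      norm_num at h ⊢
      linarith
    have hk := doeblin_kato_kernelDiff hKato hν hST hb hdiv hbd hK₁ hK₂ hC₁ hC₂ hup₁ hup₂ hlt hI1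
    refine le_antisymm (hk.trans (le_of_eq ha1')) (integral_nonneg fun x => abs_nonneg _)
  have hzero := doeblin_eq_zero_of_integral_abs
    ((hK₁.contDiff_slice ht).continuous.sub (hK₂.contDiff_slice ht).continuous)
    ((hK₁.integrable ht).sub (hK₂.integrable ht)) h0
  funext x
  exact sub_eq_zero.1 (hzero x)

end Summit.NavierStokesRegularity.NavierStokesRegularity.Theorems.AdaptedFrequencyConverges.CloudFrameEffectiveTsai

end
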